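import Mathlib
import HarnessLib
import Summits.HubbardSuperconductivity.HubbardSuperconductivity.Theorems.KLProgrammeKLRegimeSplitDefs

/-!
# Route `KLProgramme` — the four CLOSED children of crux K3 `KLRegimeTwoPointLimit` (stmt-HubbardSuperconductivity-19937),
# v2 = the statements to be FILED (plan g9 review 2026-08-26T07:50:26Z Δ1–Δ3 folded in), and their glue, PROVED.  Seat p2.

`KLProgrammeKLRegimeSplitDefs.lean` (Part 3) carries the first typing of the children (`KLRegimeEngine`, …, glue
`klRegime_induction`); the tree is append-only, so the revised statements live HERE under the namespace `…KLRegimeSplit.Child`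
(the route's child items are `def KLRegimeEngine : Prop := …KLRegimeSplit.Child.Engine` etc.; Part 3's v1 `Prop`s are superseded
and unreferenced).  What changed and why (plan g9's review of the draft):

* **Δ1 — the renormalised frame is VOLUME-UNIFORM.**  `Child.Counterterm` concludes ONE admissible frame `K` chosen BEFORE the
  volume (`∃ K, FrameOK … K ∧ ∃ Lc Mc, ∀ L ≥ Lc, ∀ M ≥ Mc L, ∀ n ≤ n_β, RenormalisedAt … K n`), from a hypothesis valid beyond
  ARBITRARY thresholds `(Lh, Mh)` (so that the glue can feed the maxed thresholds of children 3 and 1); `Child.TwoPointAssembly`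
  takes ONE frame good for all `L ≥ L⋆`, `M ≥ M⋆ L`.  Reason: with a frame `K_{L,M}` per volume, child 4 would have to compare two
  scale decompositions in different frames (an `O(U)` frame mismatch no hypothesis controls); with one frame it is termwise
  volume limits of ONE decomposition (BGM 2006 §2.4's setting — the counterterm is the infinite-volume one).  Cost to child 2:
  finite-volume / Matsubara corrections sit inside `RenormalisedAt`'s tolerances `cr|U|Λ_n`, `cz|U|` (hence Δ2).
* **Δ2 — every child carries its OWN thresholds** as functions of `(β, U)` (volume) and `(β, U, L)` (Matsubara cutoff); Part 1's
  `Q.L0`, `Q.M0` are no longer read.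
* **Δ3 — the steps assume the FULL history** `Child.Hist n` = split ∧ renormalisation ∧ engine bounds ∧ two-leg step at every
  `j < n` (the scale-`n` tree expansion uses the kernel bounds at `j < n`); child 1 also receives `TwoLegStep n`; the two-leg
  step is Part 2's v2 `TwoLegStep` (frame-Lipschitz clause `FrameLipschitz` with the same history for the comparison frame).

Constants are threaded `G → P → Q → (R, c) → U₀` as in Part 1's module doc.  The glue `Child.induction : Engine → BetaSplit →
Counterterm → TwoPointAssembly → KLRegimeTwoPointLimitMu (-1) (-0.15)` is PROVED (pure-logic strong induction `Child.allScales`,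
`isKLRegime_of_le_tempScaleIdx`, `klBetaMin_le_of_exp_le`, thresholds maxed); `Child.twoPointLimit_of_children` gives K3's body
from S0 stated structurally; the K3-NAMED glue lives downstream in `KLProgrammeKLRegimeSplitGlue.lean` (imports the route file).
Nothing here asserts anything about the Hubbard model.  References: HOME/DECOMP.md v8 §8 (j); HOME/planner-g9/SPLIT-ARCH.md.
-/

noncomputable section

namespace Summit.HubbardSuperconductivity.HubbardSuperconductivity.Theorems.KLRegimeSplit.Child

set_option linter.dupNamespace false -- summit = problem name (single-conjunct summit), D-0017

open Real Finset Filter Literature.MathematicalPhysics.QuantumLattice Literature.Probability.LatticeModels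
open Literature.MathematicalPhysics.QuantumLattice.FermiRG
open Summit.HubbardSuperconductivity.HubbardSuperconductivity.Theorems.KLProgrammeLegKernels
open Summit.HubbardSuperconductivity.HubbardSuperconductivity.Theorems.DispersionFlow

/-! ## §1 The history and the four children -/

section Model

variable (L M : ℕ) [NeZero L] [NeZero M]

/-- **The history below scale `n`**: at every `j < n` the split, the renormalisation of the frame, the engine bounds and the
two-leg step (v2) hold — what the scale-`n` tree expansion may use; the glue's strong induction supplies it. -/
def Hist (G : GeoConsts) (P : SplitConsts) (Q : EngConsts) (R : RenConsts) (β U μ : ℝ) (K : TrigPolyC4v) (n : ℕ) : Prop :=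
  ∀ j < n, BetaSplitAt L M G P Q β U μ K j ∧ RenormalisedAt L M β U μ K R j ∧
    EngineBoundsAt L M G P Q β U μ K j ∧ TwoLegStep L M G P Q R β U μ K j

end Model

/-- **Child 3 `Engine` (route name `KLRegimeEngine`; rank 2; DECOMP C5b + C4a's two-leg output in the CT scheme).**  There are
absolute constants `G` such that for every choice `P` of the flow's induction constants there are engine constants `Q` such that
for every renormalisation package `R` and every regime constant `c > 0` there are `U₀ > 0` and thresholds `L₃ β U`, `M₃ β U L`
with: for `μ` in the analysis window, `0 < U ≤ U₀`, `klBetaMin ≤ β ≤ e^{c/U²}`, every ADMISSIBLE frame `K` (`FrameOK`), every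
`L ≥ L₃ β U`, `M ≥ M₃ β U L` and every scale `n ≤ n_β` in the KL regime: IF the history `Hist n` holds, THEN the scale-`n` kernel
bounds `EngineBoundsAt n` and the two-leg step `TwoLegStep n` hold — the `n!`-free fermionic tree expansion with anisotropic
sectors for OUR action (BGM 2006 Thm 2.1's role with `|U||h| ≤ c₀` replaced by the split; App. D U1–U7), one scale at a time. -/
def Engine : Prop :=
  ∃ G : GeoConsts, G.WF ∧ ∀ P : SplitConsts, P.WF → ∃ Q : EngConsts, Q.WF ∧ ∀ R : RenConsts, R.WF → ∀ c : ℝ, 0 < c →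
    ∃ U₀ : ℝ, 0 < U₀ ∧ ∃ L₃ : ℝ → ℝ → ℕ, ∃ M₃ : ℝ → ℝ → ℕ → ℕ,
      ∀ μ ∈ klWindow, ∀ U : ℝ, 0 < U → U ≤ U₀ → ∀ β : ℝ, klBetaMin ≤ β → β ≤ Real.exp (c / U ^ 2) →
        ∀ K : TrigPolyC4v, FrameOK R U (nScales β) μ K →
          ∀ (L M : ℕ) [NeZero L] [NeZero M], L₃ β U ≤ L → M₃ β U L ≤ M →
            ∀ n : ℕ, n ≤ nScales β → IsKLRegime U c (-(n : ℤ)) → Hist L M G P Q R β U μ K n →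
              EngineBoundsAt L M G P Q β U μ K n ∧ TwoLegStep L M G P Q R β U μ K n

/-- **Child 1 `BetaSplit` (route name `KLRegimeBetaSplit`; rank 3; DECOMP C1 = Lemma E.4 as ONE cascade step).**  For all absolute
constants `G` there are induction constants `P` such that for all engine constants `Q` there is `c₀ > 0` (no onset: where
`β ≤ e^{c/U²}` is spent) such that for every `0 < c ≤ c₀` and every `R` there are `U₀ > 0` and thresholds `L₁ β U`, `M₁ β U L`
with: in the regime, for every admissible frame, every large volume and every scale `n ≤ n_β`: the history below `n` together
with the engine's scale-`n` output (`EngineBoundsAt n`, `TwoLegStep n`) gives the split AT scale `n` — the Cooper blocks stay in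
C2's Riccati envelopes (`attractiveEnvelope_step` / `repulsiveEnvelope_step` on (E2)), the endpoint line and the first moments
are restored, the non-Cooper tuples are frozen ((E2′) summed with `G`'s freezing bounds = Lemma E.1/E.3). -/
def BetaSplit : Prop :=
  ∀ G : GeoConsts, G.WF → ∃ P : SplitConsts, P.WF ∧ ∀ Q : EngConsts, Q.WF → ∃ c₀ : ℝ, 0 < c₀ ∧
    ∀ c : ℝ, 0 < c → c ≤ c₀ → ∀ R : RenConsts, R.WF →
      ∃ U₀ : ℝ, 0 < U₀ ∧ ∃ L₁ : ℝ → ℝ → ℕ, ∃ M₁ : ℝ → ℝ → ℕ → ℕ,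
        ∀ μ ∈ klWindow, ∀ U : ℝ, 0 < U → U ≤ U₀ → ∀ β : ℝ, klBetaMin ≤ β → β ≤ Real.exp (c / U ^ 2) →
          ∀ K : TrigPolyC4v, FrameOK R U (nScales β) μ K →
            ∀ (L M : ℕ) [NeZero L] [NeZero M], L₁ β U ≤ L → M₁ β U L ≤ M →
              ∀ n : ℕ, n ≤ nScales β → IsKLRegime U c (-(n : ℤ)) → Hist L M G P Q R β U μ K n →
                EngineBoundsAt L M G P Q β U μ K n → TwoLegStep L M G P Q R β U μ K n →
                  BetaSplitAt L M G P Q β U μ K n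

/-- **Child 2 `Counterterm` (route name `KLRegimeCounterterm`; rank 4; DECOMP C4 in the counterterm scheme = FST's inversion by
successive approximation), VOLUME-UNIFORM.**  For all `G, P, Q` there are a renormalisation package `R` and `c₁ > 0` such that for
every `0 < c ≤ c₁` there is `U₀ > 0` with: at every regime point `(μ, U, β)` and for ANY thresholds `(Lh, Mh)`: IF for every
admissible frame `K` and every `L ≥ Lh`, `M ≥ Mh L` the frame's renormalisation below `n` yields the engine's output, the two-leg
step and the split at `n` (all `n ≤ n_β` — exactly what the glue's induction makes of children 3 and 1), THEN there is ONE
admissible frame `K` (chosen BEFORE the volume: the volume-uniform counterterm) with thresholds `(Lc, Mc)` such that `K` is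
renormalised down to EVERY scale `n ≤ n_β` at every `L ≥ Lc`, `M ≥ Mc L`: the counterterm map `K ↦ -Σ_n ℓ_n(K)` maps the frame ball
into itself (sizes + tangential floor of (E3), p2 g2's `GeomConstants.of_perturbation`, the analysis-window geometry) and is a
contraction (`FrameLipschitz`); finite-volume / Matsubara corrections sit inside the tolerances `cr|U|Λ_n`, `cz|U|`. -/
def Counterterm : Prop :=
  ∀ G : GeoConsts, ∀ P : SplitConsts, ∀ Q : EngConsts, G.WF → P.WF → Q.WF →
    ∃ R : RenConsts, R.WF ∧ ∃ c₁ : ℝ, 0 < c₁ ∧ ∀ c : ℝ, 0 < c → c ≤ c₁ → ∃ U₀ : ℝ, 0 < U₀ ∧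
      ∀ μ ∈ klWindow, ∀ U : ℝ, 0 < U → U ≤ U₀ → ∀ β : ℝ, klBetaMin ≤ β → β ≤ Real.exp (c / U ^ 2) →
        ∀ (Lh : ℕ) (Mh : ℕ → ℕ),
          (∀ K : TrigPolyC4v, FrameOK R U (nScales β) μ K →
            ∀ (L M : ℕ) [NeZero L] [NeZero M], Lh ≤ L → Mh L ≤ M →
              ∀ n : ℕ, n ≤ nScales β → (∀ j < n, RenormalisedAt L M β U μ K R j) →
                EngineBoundsAt L M G P Q β U μ K n ∧ TwoLegStep L M G P Q R β U μ K n ∧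
                  BetaSplitAt L M G P Q β U μ K n) →
          ∃ K : TrigPolyC4v, FrameOK R U (nScales β) μ K ∧ ∃ (Lc : ℕ) (Mc : ℕ → ℕ),
            ∀ (L M : ℕ) [NeZero L] [NeZero M], Lc ≤ L → Mc L ≤ M →
              ∀ n : ℕ, n ≤ nScales β → RenormalisedAt L M β U μ K R n

/-- **Child 4 `TwoPointAssembly` (route name `KLRegimeTwoPointAssembly`; rank 5; BGM 2006 §2.4 / Lemmas 2.4–2.5 role).**  For all
constants and every regime constant `c > 0` there is `U₀ > 0` with: in the regime at `(μ, U, β)`, IF there is ONE admissible frame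
`K` that is renormalised, split, engine-bounded and two-leg-controlled at every scale `n ≤ n_β` for all volumes `L ≥ L⋆` and
Matsubara cutoffs `M ≥ M⋆ L`, THEN the finite-volume equal-time thermal two-point functions of the Hubbard torus at `(β, U, μ)`
converge as `L → ∞` (one scale decomposition in a fixed frame: termwise volume limits of Riemann sums + uniform tails; `M → ∞`
first, tree `HubbardThermalTwoPointMatsubaraLimit`). -/
def TwoPointAssembly : Prop :=
  ∀ G : GeoConsts, ∀ P : SplitConsts, ∀ Q : EngConsts, ∀ R : RenConsts, G.WF → P.WF → Q.WF → R.WF →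
    ∀ c : ℝ, 0 < c → ∃ U₀ : ℝ, 0 < U₀ ∧
      ∀ μ ∈ klWindow, ∀ U : ℝ, 0 < U → U ≤ U₀ → ∀ β : ℝ, klBetaMin ≤ β → β ≤ Real.exp (c / U ^ 2) →
        ∀ (Lstar : ℕ) (Mstar : ℕ → ℕ),
          (∃ K : TrigPolyC4v, FrameOK R U (nScales β) μ K ∧
            ∀ (L M : ℕ) [NeZero L] [NeZero M], Lstar ≤ L → Mstar L ≤ M → ∀ n : ℕ, n ≤ nScales β →
              RenormalisedAt L M β U μ K R n ∧ BetaSplitAt L M G P Q β U μ K n ∧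
                EngineBoundsAt L M G P Q β U μ K n ∧ TwoLegStep L M G P Q R β U μ K n) →
          ∀ (x y : Site 2) (σ σ' : Fin 2), ∃ S : ℂ,
            Tendsto (fun L : ℕ => hubbardThermalTwoPoint β U μ L x y σ σ') atTop (nhds S)

/-! ## §2 The glue -/

/-- **The glued induction over the scales (children 3 + 1), pure logic**: per-scale statements `B, Rn, E, T : ℕ → Prop` (split,
renormalisation, engine bounds, two-leg step) and a side condition `KL`; if the engine step gives `E n ∧ T n` from the full
history below `n`, the flow step gives `B n` from the history and `E n`, `T n`, and `KL` holds at every scale, then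
renormalisation below `n` alone yields everything at `n`. -/
theorem allScales {N : ℕ} {KL B Rn E T : ℕ → Prop}
    (hE : ∀ n ≤ N, KL n → (∀ j < n, B j ∧ Rn j ∧ E j ∧ T j) → E n ∧ T n)
    (hB : ∀ n ≤ N, KL n → (∀ j < n, B j ∧ Rn j ∧ E j ∧ T j) → E n → T n → B n)
    (hKL : ∀ n ≤ N, KL n) :
    ∀ n ≤ N, (∀ j < n, Rn j) → E n ∧ T n ∧ B n := by
  intro n
  induction n using Nat.strong_induction_on with
  | _ n ih =>
    intro hn hR
    have hyp : ∀ j < n, B j ∧ Rn j ∧ E j ∧ T j := fun j hj => by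
      have h := ih j hj (le_of_lt (lt_of_lt_of_le hj hn)) fun i hi => hR i (hi.trans hj)
      exact ⟨h.2.2, hR j hj, h.1, h.2.1⟩
    have h1 := hE n hn (hKL n hn) hyp
    exact ⟨h1.1, h1.2, hB n hn (hKL n hn) hyp h1.1 h1.2⟩

/-- **GLUE: the four children give K3 on the analysis window** `KLRegimeTwoPointLimitMu (-1) (-0.15)` (= the registered stub
`KLRegimeAnalysisWindow`; with S0 `MuOfDopingWindow` the crux follows — `twoPointLimit_of_children`, and BY NAME in
`KLProgrammeKLRegimeSplitGlue.lean`).  Order of choices: `G` (child 3) → `P` (child 1) → `Q` (child 3) → `c₀` (child 1), `(R, c₁)`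
(child 2) → `c = min c₀ c₁` → the four `U₀`'s and `a / log 128` → per `(μ, U, β)`: the hypothesis thresholds of children 3 + 1
maxed, the strong induction `allScales` for every admissible frame, child 2's volume-uniform frame with its thresholds, child 4
beyond the max of all thresholds. -/
theorem induction (h₃ : Engine) (h₁ : BetaSplit) (h₂ : Counterterm) (h₄ : TwoPointAssembly) :
    KLRegimeTwoPointLimitMu (-1) (-0.15) := by
  intro a ha
  obtain ⟨G, hG, h₃P⟩ := h₃
  obtain ⟨P, hP, h₁Q⟩ := h₁ G hG
  obtain ⟨Q, hQ, h₃R⟩ := h₃P P hP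
  obtain ⟨c₀, hc₀, h₁c⟩ := h₁Q Q hQ
  obtain ⟨R, hR, c₁, hc₁, h₂c⟩ := h₂ G P Q hG hP hQ
  set c : ℝ := min c₀ c₁ with hc_def
  have hc : 0 < c := lt_min hc₀ hc₁
  obtain ⟨U₃, hU₃, L₃, M₃, h₃main⟩ := h₃R R hR c hc
  obtain ⟨U₁, hU₁, L₁, M₁, h₁main⟩ := h₁c c hc (min_le_left _ _) R hR
  obtain ⟨U₂, hU₂, h₂main⟩ := h₂c c hc (min_le_right _ _)
  obtain ⟨U₄, hU₄, h₄main⟩ := h₄ G P Q R hG hP hQ hR c hc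
  have hlog : 0 < Real.log klBetaMin := Real.log_pos (by norm_num [klBetaMin])
  set U₀ : ℝ := min (min (min U₁ U₂) (min U₃ U₄)) (a / Real.log klBetaMin) with hU₀_def
  have hU₀ : 0 < U₀ := lt_min (lt_min (lt_min hU₁ hU₂) (lt_min hU₃ hU₄)) (div_pos ha hlog)
  refine ⟨U₀, c, hU₀, hc, ?_⟩
  intro μ hμ U β hU hUle hβa hβc x y σ σ'
  have hμ' : μ ∈ klWindow := hμ
  have hU1 : U ≤ U₁ := hUle.trans ((min_le_left _ _).trans ((min_le_left _ _).trans (min_le_left _ _)))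
  have hU2 : U ≤ U₂ := hUle.trans ((min_le_left _ _).trans ((min_le_left _ _).trans (min_le_right _ _)))
  have hU3 : U ≤ U₃ := hUle.trans ((min_le_left _ _).trans ((min_le_right _ _).trans (min_le_left _ _)))
  have hU4 : U ≤ U₄ := hUle.trans ((min_le_left _ _).trans ((min_le_right _ _).trans (min_le_right _ _)))
  have hβmin : klBetaMin ≤ β := klBetaMin_le_of_exp_le hU hUle (min_le_right _ _) hβa
  have hβpos : 0 < β := pos_of_klBetaMin_le hβmin
  have hKL : ∀ n ≤ nScales β, IsKLRegime U c (-(n : ℤ)) := fun n hn =>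
    isKLRegime_of_le_tempScaleIdx hc.le hβpos hβc hn
  -- the glued induction (children 3 + 1) for EVERY admissible frame, beyond the maxed hypothesis thresholds
  have hall : ∀ K : TrigPolyC4v, FrameOK R U (nScales β) μ K →
      ∀ (L M : ℕ) [NeZero L] [NeZero M], max (L₃ β U) (L₁ β U) ≤ L → max (M₃ β U L) (M₁ β U L) ≤ M →
        ∀ n : ℕ, n ≤ nScales β → (∀ j < n, RenormalisedAt L M β U μ K R j) →
          EngineBoundsAt L M G P Q β U μ K n ∧ TwoLegStep L M G P Q R β U μ K n ∧
            BetaSplitAt L M G P Q β U μ K n := by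
    intro K hK L M _ _ hL hM n hn hRn
    have hL3 : L₃ β U ≤ L := (le_max_left _ _).trans hL
    have hL1 : L₁ β U ≤ L := (le_max_right _ _).trans hL
    have hM3 : M₃ β U L ≤ M := (le_max_left _ _).trans hM
    have hM1 : M₁ β U L ≤ M := (le_max_right _ _).trans hM
    exact allScales (N := nScales β) (KL := fun n => IsKLRegime U c (-(n : ℤ)))
      (B := fun n => BetaSplitAt L M G P Q β U μ K n) (Rn := fun n => RenormalisedAt L M β U μ K R n)
      (E := fun n => EngineBoundsAt L M G P Q β U μ K n) (T := fun n => TwoLegStep L M G P Q R β U μ K n)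
      (fun n hn hkl hyp => h₃main μ hμ' U hU hU3 β hβmin hβc K hK L M hL3 hM3 n hn hkl hyp)
      (fun n hn hkl hyp hEn hTn => h₁main μ hμ' U hU hU1 β hβmin hβc K hK L M hL1 hM1 n hn hkl hyp hEn hTn)
      hKL n hn hRn
  -- child 2: the volume-uniform renormalised admissible frame and its thresholds
  obtain ⟨K, hK, Lc, Mc, hKR⟩ :=
    h₂main μ hμ' U hU hU2 β hβmin hβc (max (L₃ β U) (L₁ β U)) (fun L => max (M₃ β U L) (M₁ β U L)) hall
  -- child 4, beyond every threshold
  refine h₄main μ hμ' U hU hU4 β hβmin hβc (max Lc (max (L₃ β U) (L₁ β U)))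
    (fun L => max (Mc L) (max (M₃ β U L) (M₁ β U L))) ⟨K, hK, ?_⟩ x y σ σ'
  intro L M _ _ hL hM n hn
  have hLc : Lc ≤ L := (le_max_left _ _).trans hL
  have hLh : max (L₃ β U) (L₁ β U) ≤ L := (le_max_right _ _).trans hL
  have hMc : Mc L ≤ M := (le_max_left _ _).trans hM
  have hMh : max (M₃ β U L) (M₁ β U L) ≤ M := (le_max_right _ _).trans hM
  have h := hall K hK L M hLh hMh n hn fun j hj => hKR L M hLc hMc j (le_of_lt (lt_of_lt_of_le hj hn))
  exact ⟨hKR L M hLc hMc n hn, h.2.2, h.1, h.2.1⟩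

/-- **The crux modulo S0, from the four children (v2)**: with `μ(δ) ∈ [-1, -0.15]` for `δ ∈ [0.10, 0.35]` (S0 `MuOfDopingWindow`,
stated structurally to keep this module free of the route file) the four children give `KLRegimeTwoPointLimit`'s body. -/
theorem twoPointLimit_of_children (h₃ : Engine) (h₁ : BetaSplit) (h₂ : Counterterm) (h₄ : TwoPointAssembly)
    (hS0 : ∀ δ ∈ Set.Icc (0.10 : ℝ) 0.35,
      chemicalPotentialOfDensity (squareDispersion 1 0) (1 - δ) ∈ Set.Icc (-1 : ℝ) (-0.15)) :
    ∀ a : ℝ, 0 < a → ∃ U₀ c : ℝ, 0 < U₀ ∧ 0 < c ∧ ∀ δ ∈ Set.Icc (0.10 : ℝ) 0.35, ∀ U β : ℝ, 0 < U → U ≤ U₀ →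
      Real.exp (a / U) ≤ β → β ≤ Real.exp (c / U ^ 2) → ∀ (x y : Site 2) (σ σ' : Fin 2), ∃ S : ℂ,
        Tendsto (fun L : ℕ => hubbardThermalTwoPoint β U
          (chemicalPotentialOfDensity (squareDispersion 1 0) (1 - δ)) L x y σ σ') atTop (nhds S) := by
  intro a ha
  obtain ⟨U₀, c, hU₀, hc, H⟩ := induction h₃ h₁ h₂ h₄ a ha
  exact ⟨U₀, c, hU₀, hc, fun δ hδ U β hU hUle hβ hβ' x y σ σ' => H _ (hS0 δ hδ) U β hU hUle hβ hβ' x y σ σ'⟩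

end Summit.HubbardSuperconductivity.HubbardSuperconductivity.Theorems.KLRegimeSplit.Child

end
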